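import Mathlib
import Summits.Ventures.PercRepro2.SplitMono

/-!
# (INC-REIMER): the Reimer slack is monotone in the split set
(seat mine-b, cell pub-perc-repro2; conjectures/MINE-B.md §13 Addendum 7)

For increasing events `A`, `B` on the subsets of `E`, pins `O` and a split set `Y`, the **Reimer slack**
is `reimerSlack A B O Y = #{γ ⊆ Y : O ∪ γ ∈ A ∧ O ∪ (Y \ γ) ∈ B} − #{γ ⊆ Y : A □ B at O ∪ γ}`;
Reimer's inequality in its pattern form (`reimer_increasing`) says it is non-negative.  The row
(INC-REIMER) says that it never decreases when an element joins the split set (`IncReimer`); it is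
census-true on all pairs of up-sets on 4 elements and on every random pair tested to 7 elements
(MINE-B.md §13 Addendum 7).  Here: the slack of the empty split set is non-negative
(`reimerSlack_empty_nonneg`), hence **(INC-REIMER) implies Reimer's inequality on every pattern**
by induction on the split set (`reimerSlack_nonneg_of_incReimer`) — an inductive route to BK/Reimer for
increasing events; and for `B = A` the Reimer slack is the STEP slack at the row `(0,2)`
(`reimerSlack_self_eq_slack`), so (INC-REIMER) for `(A, A)` is (SPLIT-MONO) at its first row.
-/

open Finset

namespace Summit.Ventures.PercRepro2

namespace StepZero

open ReimerCube

variable {E : Type*} [DecidableEq E]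

open Classical

/-- the Reimer slack of the pattern `(O, Y)` for the events `A`, `B`:
`#{γ ⊆ Y : O ∪ γ ∈ A ∧ O ∪ (Y \ γ) ∈ B} − #{γ ⊆ Y : A □ B at O ∪ γ}` -/
noncomputable def reimerSlack (A B : Finset E → Prop) (O Y : Finset E) : ℤ :=
  ((Y.powerset.filter (fun γ => A (O ∪ γ) ∧ B (O ∪ (Y \ γ)))).card : ℤ)
    - (Y.powerset.filter (fun γ => DOcc A B (O ∪ γ))).card

/-- **(INC-REIMER)** for the events `A`, `B`: adding an element to the split set never decreases the
Reimer slack -/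
def IncReimer (A B : Finset E → Prop) : Prop :=
  ∀ (O Y : Finset E) (q : E), q ∉ O → q ∉ Y → reimerSlack A B O Y ≤ reimerSlack A B O (insert q Y)

omit [DecidableEq E] in
/-- disjoint occurrence at a set gives both events at that set -/
lemma A_and_B_of_dOcc {A B : Finset E → Prop} {S : Finset E} (h : DOcc A B S) : A S ∧ B S := by
  obtain ⟨K, L, hK, hL, -, hAK, hBL⟩ := h
  exact ⟨hAK S hK, hBL S hL⟩

/-- with no split element the Reimer slack is non-negative -/
lemma reimerSlack_empty_nonneg (A B : Finset E → Prop) (O : Finset E) :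
    0 ≤ reimerSlack A B O ∅ := by
  unfold reimerSlack
  have h : (∅ : Finset E).powerset.filter (fun γ => DOcc A B (O ∪ γ))
      ⊆ (∅ : Finset E).powerset.filter (fun γ => A (O ∪ γ) ∧ B (O ∪ (∅ \ γ))) := by
    intro γ hγ
    rw [Finset.mem_filter] at hγ ⊢
    refine ⟨hγ.1, ?_⟩
    rw [Finset.mem_powerset, Finset.subset_empty] at hγ
    obtain ⟨rfl, h2⟩ := hγ
    have := A_and_B_of_dOcc h2
    simpa using this
  have := Finset.card_le_card h
  omega

/-- **(INC-REIMER) implies Reimer's inequality on every pattern**: by induction on the split set, the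
Reimer slack of every pattern `(O, Y)` with `O`, `Y` disjoint is non-negative. -/
theorem reimerSlack_nonneg_of_incReimer {A B : Finset E → Prop} (h : IncReimer A B) (O Y : Finset E)
    (hOY : Disjoint O Y) : 0 ≤ reimerSlack A B O Y := by
  induction Y using Finset.induction_on with
  | empty => exact reimerSlack_empty_nonneg A B O
  | insert q Y hq ih =>
    have hqO : q ∉ O := fun h' => Finset.disjoint_left.mp hOY h' (Finset.mem_insert_self q Y)
    have hd' : Disjoint O Y := Finset.disjoint_of_subset_right (Finset.subset_insert q Y) hOY
    exact le_trans (ih hd') (h O Y q hqO hq)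

/-- the Reimer slack of `(A, A)` is the STEP slack at the row `(0,2)`:
`T(1,1) − T(0,2) = H(1,1) − H(0,2)` (the common part `T(1,2) = T(2,1)` cancels, `absT_swap`) -/
theorem reimerSlack_self_eq_slack {A : Finset E → Prop} (hA : Incr A) (O Y : Finset E) :
    reimerSlack A A O Y = slack A O Y 0 2 := by
  unfold reimerSlack slack
  have h1 : (Y.powerset.filter (fun γ => A (O ∪ γ) ∧ A (O ∪ (Y \ γ)))).card = absT A O Y 1 1 := by
    unfold absT pinK
    congr 1
    ext γ
    rw [Finset.mem_filter, Finset.mem_filter]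
    apply and_congr_right
    intro _
    rw [kDisj_one_iff hA, kDisj_one_iff hA, and_comm]
  have h2 : (Y.powerset.filter (fun γ => DOcc A A (O ∪ γ))).card = absT A O Y 0 2 := by
    unfold absT pinK
    congr 1
    ext γ
    rw [Finset.mem_filter, Finset.mem_filter]
    apply and_congr_right
    intro _
    show DOcc A A (O ∪ γ) ↔ (kDisj A 0 (O ∪ (Y \ γ)) ∧ DOcc A (kDisj A 1) (O ∪ γ))
    constructor
    · intro h
      exact ⟨trivial, DOcc.mono_right (fun T hT => (kDisj_one_iff hA T).mpr hT) h⟩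
    · rintro ⟨-, h⟩
      exact DOcc.mono_right (fun T hT => (kDisj_one_iff hA T).mp hT) h
  rw [h1, h2, absT_eq_add_absH A O Y 0 2, absT_eq_add_absH A O Y 1 1, absT_swap A O Y 2 1]
  push_cast
  ring

end StepZero

end Summit.Ventures.PercRepro2
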